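import Summits.QuantumFields.QCD.Theses.EulerDescent
import Summits.QuantumFields.QCD.Theorems.MassiveBody.Negative.MassBlind
import Summits.QuantumFields.QCD.Theorems.GluonicCompletion.Negative.Threshold

/-!
# Crux `RetypedContinuumComplement` (stmt-QuantumFields-16903, route EulerDescent, rank 5) — negative side:
# which hypotheses are load-bearing

Refuter crux-attack record (standing disprover, cycle 1, 2026-08-17), definition-free and sorry-free; NO
refutation is claimed.  The crux reads, for `N_f ∈ {2,3}` and every `reg : QCDRegularisation N_f`,

  (H1) `reg.HasMassScaling` → (H2) `(reg.scheme 0 0 0).HasAsymptoticScaling` → (H3) `∀ᶠ k, −1 < m_crit k` →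
  (H4) heavy body (`∃ M_h > 0`, the `QCDOf` body at every tuple `≥ M_h`) → (H5) a uniform lattice gap at
  every positive tuple → the `QCDOf` body at every positive tuple.

Every counter-model must carry (H4) — non-trivial OS data with dynamical flavour-changing pseudoscalars as
the FULL-SEQUENCE continuum limit of honest lattice QCD at heavy masses — which the tree cannot construct,
and the junk inhabitants of the body's shape fail `IsNontrivial`; so `¬ RetypedContinuumComplement` is out
of reach and this file FENCES the crux instead:

* §1 `hasAsymptoticScaling_of_heavyBody`, `retypedContinuumComplement_iff_withoutAF` — (H2) is NOT
  load-bearing (it is a field of `IsQCDAlong` in (H4) and reads neither masses nor renormalisations);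
  `weakBranch_of_heavyBody` — (H4) gives only `−1 − a_k M_h/Z_m(k) < m_crit(k)`, short of (H3).
* §2 `body_all_of_withoutGap` — WITHOUT (H5) the crux, applied to the down-shift
  `m_crit ↦ m_crit − a_k c/Z_m(k)` (`GluonicCompletion.Negative.scheme_mcrit_shift`; (H1)(H2)(H4) are
  shift-blind, (H3) survives on the deep branch), proves the body at EVERY REAL tuple — at the chiral point
  and at negative renormalised masses; `withoutGap_false_of_gaplessChiralPoint`: the gap-less variant is
  false modulo "some regularisation carrying heavy QCD has no uniform lattice gap at zero mass" (Goldstone).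
  Any proof must consume the light-mass lattice gap.
* §3 `massBlind_of_subseqHeavyBody` — with (H4) weakened to a heavy body ALONG A SUBSEQUENCE the crux,
  applied to the period-two interleaving of an honest `reg` with its RGI up-shift by `M`
  (`MassiveBody.Negative.exists_interleave`; (H1)(H2)(H3)(H5) and the weakened (H4) pass to it), proves
  MASS-BLIND continuum data (one `T` QCD along `reg` at `m` and at `m + M·1`);
  `subseqVariant_false_of_massResolving`: false modulo "continuum data resolve a quark-mass shift"
  (`m_π² ∝ m_q`).  Any proof must use convergence along the WHOLE sequence at heavy masses — not
  subsequential limits or compactness — which is the identity-theorem step of the crux's picked line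
  `vitali-mass-descent` (heavy segment = uniqueness set).

Axioms `propext`, `Classical.choice`, `Quot.sound`.  Refs: `MassiveBody/Negative/MassBlind.lean`,
`GluonicCompletion/Negative/Threshold.lean`; Montvay–Münster 1994 §5.1 (additive mass renormalisation of
Wilson fermions known to `O(aΛ)` only); Gell-Mann–Oakes–Renner 1968. [folklore]
-/

noncomputable section

namespace Summit.QuantumFields.QCD.Theorems.RetypedContinuumComplement.Negative

open Filter Topology
open Literature.MathematicalPhysics.AQFT Literature.MathematicalPhysics.QuantumLattice
  Literature.MathematicalPhysics.QuantumFieldTheory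
open Summit.QuantumFields.QCD.Theses.EulerDescent (RetypedContinuumComplement)
open Summit.QuantumFields.QCD.Theorems.MassiveBody.Negative
open Summit.QuantumFields.QCD.Theorems.GluonicCompletion.Negative (scheme_mcrit_shift)

variable {Nf : ℕ}

/-! ## §1 (H2) is redundant; what (H4) gives towards (H3) -/

/-- **(H2) follows from (H4)**: asymptotic scaling is a field of `IsQCDAlong` at the heavy degenerate tuple
and reads neither the masses nor the species renormalisations. [folklore] -/
theorem hasAsymptoticScaling_of_heavyBody (reg : QCDRegularisation Nf)
    (hheavy : ∃ Mh : ℝ, 0 < Mh ∧ ∀ m : Fin Nf → ℝ, (∀ f, Mh ≤ m f) →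
      ∃ (z shift : QCDField Nf → ℕ → ℝ) (T : OSData (QCDField Nf) 4),
        IsQCDAlong (reg.scheme m z shift) T ∧ T.IsNontrivial QCDField.glue ∧ T.IsNonGaussian QCDField.glue ∧
          (∀ f g : Fin Nf, f ≠ g → T.IsNontrivial (QCDField.pseudoRe f g)) ∧
            ∃ Δ > 0, T.HasMassGap Δ ∧ (reg.scheme m z shift).HasLatticeMassGap Δ) :
    (reg.scheme 0 0 0).HasAsymptoticScaling := by
  obtain ⟨Mh, _, hb⟩ := hheavy
  obtain ⟨z, shift, T, hQ, -⟩ := hb (fun _ => Mh) (fun _ => le_rfl)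
  exact hQ.1

/-- **(H2) is not load-bearing**: the crux is equivalent to itself with (H2) deleted. [folklore] -/
theorem retypedContinuumComplement_iff_withoutAF :
    RetypedContinuumComplement ↔
      ∀ Nf : ℕ, Nf = 2 ∨ Nf = 3 → ∀ reg : QCDRegularisation Nf, reg.HasMassScaling →
        (∀ᶠ k in atTop, (-1 : ℝ) < reg.mcrit k) →
        (∃ Mh : ℝ, 0 < Mh ∧ ∀ m : Fin Nf → ℝ, (∀ f, Mh ≤ m f) →
          ∃ (z shift : QCDField Nf → ℕ → ℝ) (T : OSData (QCDField Nf) 4),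
            IsQCDAlong (reg.scheme m z shift) T ∧ T.IsNontrivial QCDField.glue ∧
              T.IsNonGaussian QCDField.glue ∧
              (∀ f g : Fin Nf, f ≠ g → T.IsNontrivial (QCDField.pseudoRe f g)) ∧
                ∃ Δ > 0, T.HasMassGap Δ ∧ (reg.scheme m z shift).HasLatticeMassGap Δ) →
        (∀ m : Fin Nf → ℝ, (∀ f, 0 < m f) → ∃ Δ > 0, (reg.scheme m 0 0).HasLatticeMassGap Δ) →
        ∀ m : Fin Nf → ℝ, (∀ f, 0 < m f) →
          ∃ (z shift : QCDField Nf → ℕ → ℝ) (T : OSData (QCDField Nf) 4),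
            IsQCDAlong (reg.scheme m z shift) T ∧ T.IsNontrivial QCDField.glue ∧
              T.IsNonGaussian QCDField.glue ∧
              (∀ f g : Fin Nf, f ≠ g → T.IsNontrivial (QCDField.pseudoRe f g)) ∧
                ∃ Δ > 0, T.HasMassGap Δ ∧ (reg.scheme m z shift).HasLatticeMassGap Δ :=
  ⟨fun h Nf hNf reg hms hbr hheavy hgap m hm =>
      h Nf hNf reg hms (hasAsymptoticScaling_of_heavyBody reg hheavy) hbr hheavy hgap m hm,
    fun h Nf hNf reg hms _ hbr hheavy hgap m hm => h Nf hNf reg hms hbr hheavy hgap m hm⟩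

/-- **What (H4) gives towards (H3)**: only `−1 − a_k M_h/Z_m(k) < m_crit(k)` eventually (the branch clause of
the heavy degenerate tuple), a window of width `O(a_k/Z_m(k))` short of (H3); (H3) is consumed by the branch
clause of `IsQCDAlong` at light tuples. [folklore] -/
theorem weakBranch_of_heavyBody (reg : QCDRegularisation Nf) (hNf : Nf ≠ 0)
    (hheavy : ∃ Mh : ℝ, 0 < Mh ∧ ∀ m : Fin Nf → ℝ, (∀ f, Mh ≤ m f) →
      ∃ (z shift : QCDField Nf → ℕ → ℝ) (T : OSData (QCDField Nf) 4),
        IsQCDAlong (reg.scheme m z shift) T ∧ T.IsNontrivial QCDField.glue ∧ T.IsNonGaussian QCDField.glue ∧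
          (∀ f g : Fin Nf, f ≠ g → T.IsNontrivial (QCDField.pseudoRe f g)) ∧
            ∃ Δ > 0, T.HasMassGap Δ ∧ (reg.scheme m z shift).HasLatticeMassGap Δ) :
    ∃ Mh : ℝ, 0 < Mh ∧ ∀ᶠ k in atTop, (-1 : ℝ) - reg.a k * Mh / reg.Zm k < reg.mcrit k := by
  obtain ⟨Mh, hMh, hb⟩ := hheavy
  obtain ⟨z, shift, T, hQ, -⟩ := hb (fun _ => Mh) (fun _ => le_rfl)
  refine ⟨Mh, hMh, ?_⟩
  filter_upwards [hQ.2.1 ⟨0, Nat.pos_of_ne_zero hNf⟩] with k hk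
  rw [QCDRegularisation.scheme_mq] at hk
  linarith

/-! ## §2 (H5) is load-bearing: without the light-mass lattice gap the crux descends through zero mass -/

/-- **Dropping (H5) makes the crux prove the body at EVERY REAL mass tuple** (zero and negative renormalised
masses included) along any regularisation carrying heavy QCD whose critical mass stays on the deep branch
(`−1 < m_crit(k) + a_k c/Z_m(k)` eventually for every real `c`; true whenever `liminf m_crit > −1`, e.g. the
honest `m_crit(k) → 0⁻`): apply the gap-less crux to the DOWN-shift of `m_crit` by `c = 1 + Σ_f |m_f|` in RGI
units — it carries (H1)(H2)(H3)(H4) again — at the positive tuple `m + c·1`, and transport back by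
`scheme_mcrit_shift`. [folklore] -/
theorem body_all_of_withoutGap
    (h : ∀ Nf : ℕ, Nf = 2 ∨ Nf = 3 → ∀ reg : QCDRegularisation Nf, reg.HasMassScaling →
      (reg.scheme 0 0 0).HasAsymptoticScaling → (∀ᶠ k in atTop, (-1 : ℝ) < reg.mcrit k) →
      (∃ Mh : ℝ, 0 < Mh ∧ ∀ m : Fin Nf → ℝ, (∀ f, Mh ≤ m f) →
        ∃ (z shift : QCDField Nf → ℕ → ℝ) (T : OSData (QCDField Nf) 4),
          IsQCDAlong (reg.scheme m z shift) T ∧ T.IsNontrivial QCDField.glue ∧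
            T.IsNonGaussian QCDField.glue ∧
            (∀ f g : Fin Nf, f ≠ g → T.IsNontrivial (QCDField.pseudoRe f g)) ∧
              ∃ Δ > 0, T.HasMassGap Δ ∧ (reg.scheme m z shift).HasLatticeMassGap Δ) →
      ∀ m : Fin Nf → ℝ, (∀ f, 0 < m f) →
        ∃ (z shift : QCDField Nf → ℕ → ℝ) (T : OSData (QCDField Nf) 4),
          IsQCDAlong (reg.scheme m z shift) T ∧ T.IsNontrivial QCDField.glue ∧
            T.IsNonGaussian QCDField.glue ∧
            (∀ f g : Fin Nf, f ≠ g → T.IsNontrivial (QCDField.pseudoRe f g)) ∧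
              ∃ Δ > 0, T.HasMassGap Δ ∧ (reg.scheme m z shift).HasLatticeMassGap Δ)
    (hNf : Nf = 2 ∨ Nf = 3) (reg : QCDRegularisation Nf) (hms : reg.HasMassScaling)
    (haf : (reg.scheme 0 0 0).HasAsymptoticScaling)
    (hdeep : ∀ c : ℝ, ∀ᶠ k in atTop, (-1 : ℝ) < reg.mcrit k + reg.a k * c / reg.Zm k)
    (hheavy : ∃ Mh : ℝ, 0 < Mh ∧ ∀ m : Fin Nf → ℝ, (∀ f, Mh ≤ m f) →
      ∃ (z shift : QCDField Nf → ℕ → ℝ) (T : OSData (QCDField Nf) 4),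
        IsQCDAlong (reg.scheme m z shift) T ∧ T.IsNontrivial QCDField.glue ∧ T.IsNonGaussian QCDField.glue ∧
          (∀ f g : Fin Nf, f ≠ g → T.IsNontrivial (QCDField.pseudoRe f g)) ∧
            ∃ Δ > 0, T.HasMassGap Δ ∧ (reg.scheme m z shift).HasLatticeMassGap Δ)
    (m : Fin Nf → ℝ) :
    ∃ (z shift : QCDField Nf → ℕ → ℝ) (T : OSData (QCDField Nf) 4),
      IsQCDAlong (reg.scheme m z shift) T ∧ T.IsNontrivial QCDField.glue ∧ T.IsNonGaussian QCDField.glue ∧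
        (∀ f g : Fin Nf, f ≠ g → T.IsNontrivial (QCDField.pseudoRe f g)) ∧
          ∃ Δ > 0, T.HasMassGap Δ ∧ (reg.scheme m z shift).HasLatticeMassGap Δ := by
  set c : ℝ := 1 + ∑ f, |m f| with hc
  have hcpos : ∀ f, 0 < c + m f := by
    intro f
    have h1 : |m f| ≤ ∑ g, |m g| := Finset.single_le_sum (fun g _ => abs_nonneg (m g)) (Finset.mem_univ f)
    have h2 := neg_abs_le (m f)
    rw [hc]; linarith
  -- the down-shifted regularisation
  let reg' : QCDRegularisation Nf := { reg with mcrit := fun k => reg.mcrit k + reg.a k * (-c) / reg.Zm k }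
  have hsch : ∀ (m' : Fin Nf → ℝ) (z shift : QCDField Nf → ℕ → ℝ),
      reg'.scheme m' z shift = reg.scheme (fun f => -c + m' f) z shift :=
    fun m' z shift => scheme_mcrit_shift reg (-c) m' z shift
  have hms' : reg'.HasMassScaling := hms
  have haf' : (reg'.scheme 0 0 0).HasAsymptoticScaling := by rw [hsch]; exact haf
  have hbr' : ∀ᶠ k in atTop, (-1 : ℝ) < reg'.mcrit k := hdeep (-c)
  obtain ⟨Mh, hMh, hb⟩ := hheavy
  have hheavy' : ∃ Mh : ℝ, 0 < Mh ∧ ∀ m : Fin Nf → ℝ, (∀ f, Mh ≤ m f) →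
      ∃ (z shift : QCDField Nf → ℕ → ℝ) (T : OSData (QCDField Nf) 4),
        IsQCDAlong (reg'.scheme m z shift) T ∧ T.IsNontrivial QCDField.glue ∧ T.IsNonGaussian QCDField.glue ∧
          (∀ f g : Fin Nf, f ≠ g → T.IsNontrivial (QCDField.pseudoRe f g)) ∧
            ∃ Δ > 0, T.HasMassGap Δ ∧ (reg'.scheme m z shift).HasLatticeMassGap Δ := by
    have hc0 : 0 < c := by rw [hc]; positivity
    refine ⟨Mh + c, by linarith, fun m' hm' => ?_⟩
    obtain ⟨z, shift, T, hQ, hnt, hng, hps, Δ, hΔ, hT, hlat⟩ :=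
      hb (fun f => -c + m' f) (fun f => by linarith [hm' f])
    refine ⟨z, shift, T, ?_, hnt, hng, hps, Δ, hΔ, hT, ?_⟩
    · rw [hsch]; exact hQ
    · rw [hsch]; exact hlat
  obtain ⟨z, shift, T, hQ, hnt, hng, hps, Δ, hΔ, hT, hlat⟩ :=
    h Nf hNf reg' hms' haf' hbr' hheavy' (fun f => c + m f) hcpos
  have e : (fun f => -c + (c + m f)) = m := funext fun f => by ring
  refine ⟨z, shift, T, ?_, hnt, hng, hps, Δ, hΔ, hT, ?_⟩
  · rw [hsch, e] at hQ; exact hQ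
  · rw [hsch, e] at hlat; exact hlat

/-- **`¬ (crux − H5)` modulo a gapless chiral point.**  If some `N_f ∈ {2,3}` regularisation on the deep branch
carries heavy QCD (H1,H2,H4) and has NO uniform lattice gap at zero renormalised mass (massless `N_f ≥ 2`
Wilson QCD pinned at the corner — Goldstone pions), the variant of the crux without (H5) is false.  The input
is physical and unconstructible here: a load-bearing certificate for (H5), not a refutation. [folklore] -/
theorem withoutGap_false_of_gaplessChiralPoint
    (H : ∃ Nf : ℕ, (Nf = 2 ∨ Nf = 3) ∧ ∃ reg : QCDRegularisation Nf, reg.HasMassScaling ∧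
      (reg.scheme 0 0 0).HasAsymptoticScaling ∧
      (∀ c : ℝ, ∀ᶠ k in atTop, (-1 : ℝ) < reg.mcrit k + reg.a k * c / reg.Zm k) ∧
      (∃ Mh : ℝ, 0 < Mh ∧ ∀ m : Fin Nf → ℝ, (∀ f, Mh ≤ m f) →
        ∃ (z shift : QCDField Nf → ℕ → ℝ) (T : OSData (QCDField Nf) 4),
          IsQCDAlong (reg.scheme m z shift) T ∧ T.IsNontrivial QCDField.glue ∧
            T.IsNonGaussian QCDField.glue ∧
            (∀ f g : Fin Nf, f ≠ g → T.IsNontrivial (QCDField.pseudoRe f g)) ∧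
              ∃ Δ > 0, T.HasMassGap Δ ∧ (reg.scheme m z shift).HasLatticeMassGap Δ) ∧
      ∀ Δ : ℝ, 0 < Δ → ¬ (reg.scheme 0 0 0).HasLatticeMassGap Δ) :
    ¬ (∀ Nf : ℕ, Nf = 2 ∨ Nf = 3 → ∀ reg : QCDRegularisation Nf, reg.HasMassScaling →
      (reg.scheme 0 0 0).HasAsymptoticScaling → (∀ᶠ k in atTop, (-1 : ℝ) < reg.mcrit k) →
      (∃ Mh : ℝ, 0 < Mh ∧ ∀ m : Fin Nf → ℝ, (∀ f, Mh ≤ m f) →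
        ∃ (z shift : QCDField Nf → ℕ → ℝ) (T : OSData (QCDField Nf) 4),
          IsQCDAlong (reg.scheme m z shift) T ∧ T.IsNontrivial QCDField.glue ∧
            T.IsNonGaussian QCDField.glue ∧
            (∀ f g : Fin Nf, f ≠ g → T.IsNontrivial (QCDField.pseudoRe f g)) ∧
              ∃ Δ > 0, T.HasMassGap Δ ∧ (reg.scheme m z shift).HasLatticeMassGap Δ) →
      ∀ m : Fin Nf → ℝ, (∀ f, 0 < m f) →
        ∃ (z shift : QCDField Nf → ℕ → ℝ) (T : OSData (QCDField Nf) 4),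
          IsQCDAlong (reg.scheme m z shift) T ∧ T.IsNontrivial QCDField.glue ∧
            T.IsNonGaussian QCDField.glue ∧
            (∀ f g : Fin Nf, f ≠ g → T.IsNontrivial (QCDField.pseudoRe f g)) ∧
              ∃ Δ > 0, T.HasMassGap Δ ∧ (reg.scheme m z shift).HasLatticeMassGap Δ) := by
  intro h
  obtain ⟨Nf, hNf, reg, hms, haf, hdeep, hheavy, hno⟩ := H
  obtain ⟨z, shift, T, -, -, -, -, Δ, hΔ, -, hlat⟩ := body_all_of_withoutGap h hNf reg hms haf hdeep hheavy 0
  exact hno Δ hΔ hlat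

/-! ## §3 The full-sequence clause of (H4) is load-bearing: a subsequential heavy body makes QCD mass-blind -/

section Interleave

variable (reg reg' : QCDRegularisation Nf) (M : ℝ)
  (hmc' : ∀ k, reg'.mcrit k =
    reg.mcrit (k / 2) + reg.a (k / 2) * (((k % 2 : ℕ) : ℝ) * M) / reg.Zm (k / 2))

include hmc' in
/-- (H3) passes to the period-two interleaving of `reg` with its up-shift by `M ≥ 0`. [folklore] -/
theorem interleave_branch (hM : 0 ≤ M) (hbr : ∀ᶠ k in atTop, (-1 : ℝ) < reg.mcrit k) :
    ∀ᶠ k in atTop, (-1 : ℝ) < reg'.mcrit k := by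
  obtain ⟨N, hN⟩ := eventually_atTop.1 hbr
  refine eventually_atTop.2 ⟨2 * N, fun k hk => ?_⟩
  rw [hmc']
  have h1 : -1 < reg.mcrit (k / 2) := hN _ (by omega)
  have h2 : 0 ≤ reg.a (k / 2) * (((k % 2 : ℕ) : ℝ) * M) / reg.Zm (k / 2) :=
    div_nonneg (mul_nonneg (reg.a_pos _).le (mul_nonneg (Nat.cast_nonneg _) hM)) (reg.Zm_pos _).le
  linarith

include hmc' in
/-- Even critical masses of the interleaving are those of `reg`. [folklore] -/
theorem interleave_mcrit_even (j : ℕ) : reg'.mcrit (2 * j) = reg.mcrit j := by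
  have h1 : 2 * j / 2 = j := by omega
  have h2 : 2 * j % 2 = 0 := by omega
  rw [hmc', h1, h2]
  simp

end Interleave

/-- **A subsequential heavy body makes QCD mass-blind.**  Weaken (H4) to "some regularisation `reg₀` whose data
are those of `reg` along a strictly increasing `φ` carries the heavy body" (convergence of the honest lattice
functions only ALONG `φ`).  Then the crux so weakened yields, for every `reg` satisfying ALL FIVE hypotheses of
the genuine crux (full-sequence heavy body included), every `M ≥ 0` and every positive tuple `m`, ONE `T` —
non-trivial non-Gaussian glue, non-decoupled flavoured pseudoscalars, a mass gap — that is QCD along `reg`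
BOTH at masses `m` and at `m + M·1`, with one common uniform lattice gap.  Proof: the interleaving of `reg`
with its up-shift by `M` (`exists_interleave`) satisfies (H1)(H2)(H3)(H5) and the weakened (H4) (along the
even steps); split the conclusion along even and odd steps (`isQCDAlong_along`, `latticeGap_along`). [folklore] -/
theorem massBlind_of_subseqHeavyBody
    (h : ∀ Nf : ℕ, Nf = 2 ∨ Nf = 3 → ∀ reg : QCDRegularisation Nf, reg.HasMassScaling →
      (reg.scheme 0 0 0).HasAsymptoticScaling → (∀ᶠ k in atTop, (-1 : ℝ) < reg.mcrit k) →
      (∃ (φ : ℕ → ℕ) (reg₀ : QCDRegularisation Nf), StrictMono φ ∧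
        (∀ j, reg.a (φ j) = reg₀.a j) ∧ (∀ j, reg.β (φ j) = reg₀.β j) ∧ (∀ j, reg.L (φ j) = reg₀.L j) ∧
        (∀ j, reg.Zm (φ j) = reg₀.Zm j) ∧ (∀ j, reg.mcrit (φ j) = reg₀.mcrit j) ∧
        ∃ Mh : ℝ, 0 < Mh ∧ ∀ m : Fin Nf → ℝ, (∀ f, Mh ≤ m f) →
          ∃ (z shift : QCDField Nf → ℕ → ℝ) (T : OSData (QCDField Nf) 4),
            IsQCDAlong (reg₀.scheme m z shift) T ∧ T.IsNontrivial QCDField.glue ∧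
              T.IsNonGaussian QCDField.glue ∧
              (∀ f g : Fin Nf, f ≠ g → T.IsNontrivial (QCDField.pseudoRe f g)) ∧
                ∃ Δ > 0, T.HasMassGap Δ ∧ (reg₀.scheme m z shift).HasLatticeMassGap Δ) →
      (∀ m : Fin Nf → ℝ, (∀ f, 0 < m f) → ∃ Δ > 0, (reg.scheme m 0 0).HasLatticeMassGap Δ) →
      ∀ m : Fin Nf → ℝ, (∀ f, 0 < m f) →
        ∃ (z shift : QCDField Nf → ℕ → ℝ) (T : OSData (QCDField Nf) 4),
          IsQCDAlong (reg.scheme m z shift) T ∧ T.IsNontrivial QCDField.glue ∧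
            T.IsNonGaussian QCDField.glue ∧
            (∀ f g : Fin Nf, f ≠ g → T.IsNontrivial (QCDField.pseudoRe f g)) ∧
              ∃ Δ > 0, T.HasMassGap Δ ∧ (reg.scheme m z shift).HasLatticeMassGap Δ)
    (hNf : Nf = 2 ∨ Nf = 3) (reg : QCDRegularisation Nf) (hms : reg.HasMassScaling)
    (haf : (reg.scheme 0 0 0).HasAsymptoticScaling) (hbr : ∀ᶠ k in atTop, (-1 : ℝ) < reg.mcrit k)
    (hheavy : ∃ Mh : ℝ, 0 < Mh ∧ ∀ m : Fin Nf → ℝ, (∀ f, Mh ≤ m f) →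
      ∃ (z shift : QCDField Nf → ℕ → ℝ) (T : OSData (QCDField Nf) 4),
        IsQCDAlong (reg.scheme m z shift) T ∧ T.IsNontrivial QCDField.glue ∧ T.IsNonGaussian QCDField.glue ∧
          (∀ f g : Fin Nf, f ≠ g → T.IsNontrivial (QCDField.pseudoRe f g)) ∧
            ∃ Δ > 0, T.HasMassGap Δ ∧ (reg.scheme m z shift).HasLatticeMassGap Δ)
    (hgap : ∀ m : Fin Nf → ℝ, (∀ f, 0 < m f) → ∃ Δ > 0, (reg.scheme m 0 0).HasLatticeMassGap Δ)
    {M : ℝ} (hM : 0 ≤ M) (m : Fin Nf → ℝ) (hm : ∀ f, 0 < m f) :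
    ∃ (T : OSData (QCDField Nf) 4) (z₁ s₁ z₂ s₂ : QCDField Nf → ℕ → ℝ),
      IsQCDAlong (reg.scheme m z₁ s₁) T ∧ IsQCDAlong (reg.scheme (fun f => m f + M) z₂ s₂) T ∧
      T.IsNontrivial QCDField.glue ∧ T.IsNonGaussian QCDField.glue ∧
      (∀ f g : Fin Nf, f ≠ g → T.IsNontrivial (QCDField.pseudoRe f g)) ∧
      ∃ Δ > 0, T.HasMassGap Δ ∧ (reg.scheme m 0 0).HasLatticeMassGap Δ ∧
        (reg.scheme (fun f => m f + M) 0 0).HasLatticeMassGap Δ := by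
  obtain ⟨reg', ha', hβ', hL', hZ', hmc'⟩ := exists_interleave reg M
  -- (H1)(H2)(H3) pass to the interleaving
  have hms' := interleave_hasMassScaling reg reg' ha' hZ' hms
  have haf' := interleave_hasAsymptoticScaling reg reg' ha' hβ' haf
  have hbr' := interleave_branch reg reg' M hmc' hM hbr
  -- the weakened (H4): `reg`'s heavy body along the even steps
  have hheavy' : ∃ (φ : ℕ → ℕ) (reg₀ : QCDRegularisation Nf), StrictMono φ ∧
      (∀ j, reg'.a (φ j) = reg₀.a j) ∧ (∀ j, reg'.β (φ j) = reg₀.β j) ∧ (∀ j, reg'.L (φ j) = reg₀.L j) ∧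
      (∀ j, reg'.Zm (φ j) = reg₀.Zm j) ∧ (∀ j, reg'.mcrit (φ j) = reg₀.mcrit j) ∧
      ∃ Mh : ℝ, 0 < Mh ∧ ∀ m : Fin Nf → ℝ, (∀ f, Mh ≤ m f) →
        ∃ (z shift : QCDField Nf → ℕ → ℝ) (T : OSData (QCDField Nf) 4),
          IsQCDAlong (reg₀.scheme m z shift) T ∧ T.IsNontrivial QCDField.glue ∧
            T.IsNonGaussian QCDField.glue ∧
            (∀ f g : Fin Nf, f ≠ g → T.IsNontrivial (QCDField.pseudoRe f g)) ∧
              ∃ Δ > 0, T.HasMassGap Δ ∧ (reg₀.scheme m z shift).HasLatticeMassGap Δ :=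
    ⟨fun j => 2 * j, reg, fun a b hab => by dsimp only; omega, (interleave_a_eq reg reg' ha').1,
      (interleave_β_eq reg reg' hβ').1, (interleave_L_eq reg reg' hL').1,
      fun j => by show reg'.Zm (2 * j) = reg.Zm j; rw [hZ']; congr 1; omega,
      interleave_mcrit_even reg reg' M hmc', hheavy⟩
  -- (H5) passes to the interleaving: at `m'` the even steps carry the gap at `m'`, the odd ones at `m' + M·1`
  have hgap' : ∀ m' : Fin Nf → ℝ, (∀ f, 0 < m' f) → ∃ Δ > 0, (reg'.scheme m' 0 0).HasLatticeMassGap Δ := by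
    intro m' hm'
    obtain ⟨Δ₀, hΔ₀, h₀⟩ := hgap m' hm'
    obtain ⟨Δ₁, hΔ₁, h₁⟩ := hgap (fun f => m' f + M) (fun f => by linarith [hm' f])
    refine ⟨min Δ₀ Δ₁, lt_min hΔ₀ hΔ₁, ?_⟩
    exact latticeGap_interleave (latticeGap_mono h₀ (min_le_left _ _)) (latticeGap_mono h₁ (min_le_right _ _))
      (interleave_L_eq reg reg' hL').1 (interleave_β_eq reg reg' hβ').1 (interleave_a_eq reg reg' ha').1
      (interleave_mq_even reg reg' M ha' hZ' hmc' m' 0 0 0 0)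
      (interleave_L_eq reg reg' hL').2 (interleave_β_eq reg reg' hβ').2 (interleave_a_eq reg reg' ha').2
      (interleave_mq_odd reg reg' M ha' hZ' hmc' m' 0 0 0 0)
  obtain ⟨z, s, T, hQ, hnt, hng, hps, Δ, hΔ, hT, hlat⟩ := h Nf hNf reg' hms' haf' hbr' hheavy' hgap' m hm
  -- split the conclusion along even / odd steps
  refine ⟨T, fun s' j => z s' (2 * j), fun s' j => s s' (2 * j), fun s' j => z s' (2 * j + 1),
    fun s' j => s s' (2 * j + 1), ?_, ?_, hnt, hng, hps, Δ, hΔ, hT, ?_, ?_⟩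
  · exact isQCDAlong_along (fun j => 2 * j) (fun j => by omega) hQ haf
      (interleave_L_eq reg reg' hL').1 (interleave_β_eq reg reg' hβ').1 (interleave_a_eq reg reg' ha').1
      (interleave_mq_even reg reg' M ha' hZ' hmc' m z s _ _) (fun _ => rfl) (fun _ => rfl)
  · exact isQCDAlong_along (fun j => 2 * j + 1) (fun j => by omega) hQ haf
      (interleave_L_eq reg reg' hL').2 (interleave_β_eq reg reg' hβ').2 (interleave_a_eq reg reg' ha').2
      (interleave_mq_odd reg reg' M ha' hZ' hmc' m z s _ _) (fun _ => rfl) (fun _ => rfl)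
  · exact latticeGap_along (fun j => 2 * j) (fun j => by omega) hlat
      (interleave_L_eq reg reg' hL').1 (interleave_β_eq reg reg' hβ').1 (interleave_a_eq reg reg' ha').1
      (interleave_mq_even reg reg' M ha' hZ' hmc' m z s 0 0)
  · exact latticeGap_along (fun j => 2 * j + 1) (fun j => by omega) hlat
      (interleave_L_eq reg reg' hL').2 (interleave_β_eq reg reg' hβ').2 (interleave_a_eq reg reg' ha').2
      (interleave_mq_odd reg reg' M ha' hZ' hmc' m z s 0 0)

/-- **`¬ (crux with subsequential H4)` modulo mass resolution.**  If along some regularisation satisfying all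
five hypotheses of the genuine crux the continuum data RESOLVE some quark-mass shift `M > 0` at some positive
tuple (no OS data with non-trivial glue are QCD along `reg` both at `m` and at `m + M·1` — any mass dependence
of any hadronic quantity, `m_π² ∝ m_q`), the subsequential variant is false.  A proof of the crux therefore
cannot get by with subsequential limits / compactness extracted from (H4): it must use convergence along the
WHOLE sequence at heavy masses. [folklore] -/
theorem subseqVariant_false_of_massResolving
    (H : ∃ Nf : ℕ, (Nf = 2 ∨ Nf = 3) ∧ ∃ reg : QCDRegularisation Nf, reg.HasMassScaling ∧
      (reg.scheme 0 0 0).HasAsymptoticScaling ∧ (∀ᶠ k in atTop, (-1 : ℝ) < reg.mcrit k) ∧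
      (∃ Mh : ℝ, 0 < Mh ∧ ∀ m : Fin Nf → ℝ, (∀ f, Mh ≤ m f) →
        ∃ (z shift : QCDField Nf → ℕ → ℝ) (T : OSData (QCDField Nf) 4),
          IsQCDAlong (reg.scheme m z shift) T ∧ T.IsNontrivial QCDField.glue ∧
            T.IsNonGaussian QCDField.glue ∧
            (∀ f g : Fin Nf, f ≠ g → T.IsNontrivial (QCDField.pseudoRe f g)) ∧
              ∃ Δ > 0, T.HasMassGap Δ ∧ (reg.scheme m z shift).HasLatticeMassGap Δ) ∧
      (∀ m : Fin Nf → ℝ, (∀ f, 0 < m f) → ∃ Δ > 0, (reg.scheme m 0 0).HasLatticeMassGap Δ) ∧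
      ∃ M : ℝ, 0 < M ∧ ∃ m : Fin Nf → ℝ, (∀ f, 0 < m f) ∧
        ∀ (T : OSData (QCDField Nf) 4) (z₁ s₁ z₂ s₂ : QCDField Nf → ℕ → ℝ),
          IsQCDAlong (reg.scheme m z₁ s₁) T → IsQCDAlong (reg.scheme (fun f => m f + M) z₂ s₂) T →
            ¬ T.IsNontrivial QCDField.glue) :
    ¬ (∀ Nf : ℕ, Nf = 2 ∨ Nf = 3 → ∀ reg : QCDRegularisation Nf, reg.HasMassScaling →
      (reg.scheme 0 0 0).HasAsymptoticScaling → (∀ᶠ k in atTop, (-1 : ℝ) < reg.mcrit k) →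
      (∃ (φ : ℕ → ℕ) (reg₀ : QCDRegularisation Nf), StrictMono φ ∧
        (∀ j, reg.a (φ j) = reg₀.a j) ∧ (∀ j, reg.β (φ j) = reg₀.β j) ∧ (∀ j, reg.L (φ j) = reg₀.L j) ∧
        (∀ j, reg.Zm (φ j) = reg₀.Zm j) ∧ (∀ j, reg.mcrit (φ j) = reg₀.mcrit j) ∧
        ∃ Mh : ℝ, 0 < Mh ∧ ∀ m : Fin Nf → ℝ, (∀ f, Mh ≤ m f) →
          ∃ (z shift : QCDField Nf → ℕ → ℝ) (T : OSData (QCDField Nf) 4),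
            IsQCDAlong (reg₀.scheme m z shift) T ∧ T.IsNontrivial QCDField.glue ∧
              T.IsNonGaussian QCDField.glue ∧
              (∀ f g : Fin Nf, f ≠ g → T.IsNontrivial (QCDField.pseudoRe f g)) ∧
                ∃ Δ > 0, T.HasMassGap Δ ∧ (reg₀.scheme m z shift).HasLatticeMassGap Δ) →
      (∀ m : Fin Nf → ℝ, (∀ f, 0 < m f) → ∃ Δ > 0, (reg.scheme m 0 0).HasLatticeMassGap Δ) →
      ∀ m : Fin Nf → ℝ, (∀ f, 0 < m f) →
        ∃ (z shift : QCDField Nf → ℕ → ℝ) (T : OSData (QCDField Nf) 4),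
          IsQCDAlong (reg.scheme m z shift) T ∧ T.IsNontrivial QCDField.glue ∧
            T.IsNonGaussian QCDField.glue ∧
            (∀ f g : Fin Nf, f ≠ g → T.IsNontrivial (QCDField.pseudoRe f g)) ∧
              ∃ Δ > 0, T.HasMassGap Δ ∧ (reg.scheme m z shift).HasLatticeMassGap Δ) := by
  intro h
  obtain ⟨Nf, hNf, reg, hms, haf, hbr, hheavy, hgap, M, hM, m, hm, hres⟩ := H
  obtain ⟨T, z₁, s₁, z₂, s₂, h₁, h₂, hnt, -⟩ :=
    massBlind_of_subseqHeavyBody h hNf reg hms haf hbr hheavy hgap hM.le m hm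
  exact hres T z₁ s₁ z₂ s₂ h₁ h₂ hnt

end Summit.QuantumFields.QCD.Theorems.RetypedContinuumComplement.Negative

end
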